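import Mathlib
import HarnessLib
import Summits.HubbardSuperconductivity.HubbardSuperconductivity.Theorems.KLProgrammeKLRegimeSplitEngineV4
import Summits.HubbardSuperconductivity.HubbardSuperconductivity.Theorems.KLProgrammeKLRegimeWickCarriersDefs
import Summits.HubbardSuperconductivity.HubbardSuperconductivity.Theorems.KLProgrammeKLRegimeSplitEngineV9

/-!
# Route `KLProgramme` — crux K3, ENGINE child (stmt-HubbardSuperconductivity-19918 and its gen-6 successor): the engine-PRIVATE
# invariant `KernelNormsLevels` — kernel norms at FKT sector LEVELS F = 3, 5 (BGM 2006 Lemma 2.5 (2.98): `e₃ = 3`, `e₅ = 7/2`)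
# (cell gate-hubbard-kl, seat p5 g4; plan g14 (R12) ruling «T3 NOT BUNDLE: (E1-F) … type the predicate now», 2026-08-27T05:56:26Z;
# HOME/prover-p5/E5-GAIN-SCALE-N.md §3)

WHY.  The non-ladder budget `eremBar`'s `CR·(Klam|U|)³·2^{−n}` term of (E2-v9) must absorb the two-vertex Wick graphs with `k ≥ 3` lines;
every such class with a SEXTIC or OCTIC vertex (`𝒲₄⊗𝒲₆`, `𝒲₆⊗𝒲₆`, `𝒲₄⊗𝒲₈`, …) is certifiable at `2^{−n}` only if that vertex's kernel is
known with MORE THAN ONE external sector fixed: Benfatto–Giuliani–Mastropietro's Lemma 2.5 (2.98) — three external sectors fixed gain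
`γ^{h/2} = 2^{−n}`, five gain `γ^{h} = 4^{−n}` over Theorem 2.1's one-sector-fixed law (2.77) (`e₁ = 5/2`, `e₃ = 3`, `e₅ = 7/2`) = FKT's
three-level sector power counting `‖·‖_{1,Σ} : ‖·‖_{3,Σ} : ‖·‖_{5,Σ}`.  The public slot `KernelNormsV4` (`…SplitEngineV4`) states the F = 1
law only (`klAnisoLegKernelNorm` = `hubbardSectorKernelNorm` on `bgmSectorSet`: ONE leg's label fixed, the others summed).  By the typing
authority's ruling the levels are carried as a PRIVATE invariant of the engine skeleton: `stub_engine_step_norms` concludes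
`KernelNormsV4 (n+1) ∧ KernelNormsLevels (n+1)` from the history and `∀ j ≤ n, KernelNormsLevels j`; `stub_engine_step_values` takes
`∀ j ≤ n, KernelNormsLevels j`.  This file TYPES the predicate (definitions with bodies + bookkeeping lemmas; no analytic claim):

* `prescribedTuples A Ωe` — the label tuples of `A` agreeing with a partial prescription `Ωe : Fin m → Option (SectorLeg N)`
  (`none` = free leg); `levelCount Ωe` = the number of prescribed legs; `levelGainExp F = min ((F − 1)/2) 2` (F ≤ 2 ↦ 0, F = 3, 4 ↦ 1,
  F ≥ 5 ↦ 2 — fixing a further leg never increases a norm, so the even levels inherit the odd ones; BGM claim nothing beyond F = 5);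
* `klAnisoLegKernelNormAt … n m Ωe` — the anisotropic-sectorised `L¹–L^∞` norm of the scale-`n` `m`-leg kernel on the momentum-conserving
  tuples with the prescribed legs FIXED (`= klAnisoLegKernelNorm` when nothing is prescribed: `klAnisoLegKernelNormAt_none`); its Wick twin
  `klWickAnisoLegKernelNormAt` (carrier `klWickAction`);
* **`KernelNormsLevels P Q β U μ K n`** := `∀ p ≥ 3, ∀ Ωe, klAnisoLegKernelNormAt … n (2p) Ωe ≤
  Q.CE^p · (epsCoupling P U n)^{p−1} · 2^{(3p−5)n} · (2^n)^{−levelGainExp (levelCount Ωe)}` — (2.98) verbatim in the units of `KernelNormsV4`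
  (p ≥ 3: the quartic kernel's all-fixed size is the split's (H_j) / `IsoTupleL1AtS`, not repeated here); Wick twin **`KernelNormsLevelsW`**;
* bookkeeping: `prescribedTuples_subset/_none`, `klAnisoLegKernelNormAt_le` (a prescription only DROPS tuples), `levelGainExp_eq_zero_of_le_two`,
  and **`kernelNormsLevels_clause_of_kernelNormsV4`**: every clause with at most TWO prescribed legs already follows from `KernelNormsV4`
  — the invariant adds content exactly at F ≥ 3.

Definitions with bodies; nothing about the model is asserted; nothing asserts superconductivity.

References: G. Benfatto, A. Giuliani, V. Mastropietro, Ann. Henri Poincaré 7 (2006) 809–898 = arXiv:cond-mat/0507686, Theorem 2.1 (2.77),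
Lemma 2.4, Lemma 2.5 (2.98) (p0017:L104–122 of the TeX); J. Feldman, H. Knörrer, E. Trubowitz, Rev. Math. Phys. 15 (2003) 1121–1169, Def. XII /
Def. XV (three-level sectorised norms), Commun. Math. Phys. 247 (2004) 243–319, Def./Lemma VI (improved power counting); cell files
HOME/p1/E5A-NOTE.md §3 (E5a-4), HOME/prover-p5/E5-GAIN-SCALE-N.md §1–§3.
-/

noncomputable section

namespace Summit.HubbardSuperconductivity.HubbardSuperconductivity.Theorems.KLRegimeSplit

set_option linter.dupNamespace false -- summit = problem name (single-conjunct summit), D-0017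

open Real Finset Literature.MathematicalPhysics.QuantumLattice Literature.Probability.LatticeModels
open Summit.HubbardSuperconductivity.HubbardSuperconductivity.Theorems.KLProgrammeLegKernels
open Summit.HubbardSuperconductivity.HubbardSuperconductivity.Theorems.KLRegimeWick

/-! ## §1 Partial prescriptions of leg labels and the level gain -/

section Prescriptions

variable {N m : ℕ}

/-- **The tuples of `A` agreeing with a partial prescription** `Ωe` of leg labels (`Ωe i = none`: leg `i` free; `some s`: leg `i`
carries the label `s`). (BGM 2006, §2.8 (2.76): `Ω_{ext}^{(F)}` «an arbitrary subset of the sector indices … of cardinality F»). -/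
def prescribedTuples (A : Finset (Fin m → SectorLeg N)) (Ωe : Fin m → Option (SectorLeg N)) : Finset (Fin m → SectorLeg N) :=
  A.filter fun Ω => ∀ i, ∀ s ∈ Ωe i, Ω i = s

/-- **The level** of a prescription: the number `F` of prescribed legs. [folklore] -/
def levelCount (Ωe : Fin m → Option (SectorLeg N)) : ℕ := (univ.filter fun i => (Ωe i).isSome).card

/-- **The level gain exponent** `min ((F−1)/2) 2`: `0` for `F ≤ 2`, `1` for `F = 3, 4` (gain `2^{−n} = γ^{h/2}`), `2` for `F ≥ 5`
(gain `4^{−n} = γ^{h}`) (BGM 2006, Lemma 2.5 (2.98)). -/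
def levelGainExp (F : ℕ) : ℕ := min ((F - 1) / 2) 2

/-- A prescription only drops tuples. [folklore] -/
theorem prescribedTuples_subset (A : Finset (Fin m → SectorLeg N)) (Ωe : Fin m → Option (SectorLeg N)) :
    prescribedTuples A Ωe ⊆ A := filter_subset _ _

/-- The empty prescription keeps every tuple. [folklore] -/
theorem prescribedTuples_none (A : Finset (Fin m → SectorLeg N)) : prescribedTuples A (fun _ => none) = A :=
  filter_true_of_mem fun Ω _ i s hs => by simp at hs

/-- A finer prescription drops more tuples. [folklore] -/
theorem prescribedTuples_mono (A : Finset (Fin m → SectorLeg N)) {Ωe Ωe' : Fin m → Option (SectorLeg N)}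
    (h : ∀ i, ∀ s ∈ Ωe i, Ωe' i = some s) : prescribedTuples A Ωe' ⊆ prescribedTuples A Ωe := by
  intro Ω hΩ
  rw [prescribedTuples, mem_filter] at hΩ ⊢
  exact ⟨hΩ.1, fun i s hs => hΩ.2 i s (h i s hs)⟩

/-- The empty prescription has level `0`. [folklore] -/
theorem levelCount_none : levelCount (fun _ : Fin m => (none : Option (SectorLeg N))) = 0 := by
  simp [levelCount]

/-- No gain below level three. [folklore] -/
theorem levelGainExp_eq_zero_of_le_two {F : ℕ} (hF : F ≤ 2) : levelGainExp F = 0 := by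
  rw [levelGainExp]; omega

/-- Gain exponent one at levels three and four. [folklore] -/
theorem levelGainExp_eq_one {F : ℕ} (h3 : 3 ≤ F) (h4 : F ≤ 4) : levelGainExp F = 1 := by
  rw [levelGainExp]; omega

/-- Gain exponent two from level five on. [folklore] -/
theorem levelGainExp_eq_two {F : ℕ} (h5 : 5 ≤ F) : levelGainExp F = 2 := by
  rw [levelGainExp]; omega

/-- The gain exponent never exceeds two. [folklore] -/
theorem levelGainExp_le_two (F : ℕ) : levelGainExp F ≤ 2 := min_le_right _ _

end Prescriptions

/-! ## §2 The levelled kernel norms of the scale-`n` action and the invariant `KernelNormsLevels` -/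

section Model

variable (L M : ℕ) [NeZero L]

/-- **The anisotropic-sectorised `L¹–L^∞` norm of the scale-`n` `m`-leg kernel at a prescription `Ωe`**: `hubbardSectorKernelNorm` on the
momentum-conserving tuples (`bgmSectorSet`) whose prescribed legs carry the prescribed labels — one further leg (label and position) fixed by
the norm itself, the free legs summed, the positions integrated.  `F = levelCount Ωe` prescribed legs = BGM's `J^{(F)}`-type quantity
(2.76)/(2.98) for the kernel (FKT's `‖·‖_{F,Σ}` up to the pinned leg) (BGM 2006, §2.8 (2.76), Lemma 2.5 (2.98)). -/
def klAnisoLegKernelNormAt (β U μ : ℝ) (K : TrigPolyC4v) (e₀ : ℝ) (n m : ℕ) (Ωe : Fin m → Option (SectorLeg (sectorCount n))) : ℝ :=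
  hubbardSectorKernelNorm L M β (klAnisoFamily L M β μ K e₀ n)
    (prescribedTuples (bgmSectorSet L M (klAnisoFamily L M β μ K e₀ n) m) Ωe) (klEffectiveAction L M β U μ K e₀ n)

/-- The Wick twin: the same norm of the Wick-smeared scale-`n` action `klWickAction` (carrier of `KernelNormsW`) (BGM 2006, §2.8 (2.76)). -/
def klWickAnisoLegKernelNormAt (β U μ : ℝ) (K : TrigPolyC4v) (n m : ℕ) (Ωe : Fin m → Option (SectorLeg (sectorCount n))) : ℝ :=
  hubbardSectorKernelNorm L M β (klAnisoFamily L M β μ K klE0 n)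
    (prescribedTuples (bgmSectorSet L M (klAnisoFamily L M β μ K klE0 n) m) Ωe) (klWickAction L M β U μ K n)

/-- **`KernelNormsLevels P Q … K n`** — the engine-private invariant (BGM Lemma 2.5 (2.98) in the units of `KernelNormsV4`): for every
`p ≥ 3` and every prescription `Ωe` of the `2p` legs,
`‖W^{(n)}_{2p}‖_{Ωe} ≤ CE^p · ε_n^{p−1} · 2^{(3p−5)n} · (2^n)^{−levelGainExp F}`, `F = levelCount Ωe`, `ε_n = epsCoupling P U n` —
three prescribed legs gain `2^{−n}` (`e₃ − e₁ = 1/2`), five gain `4^{−n}` (`e₅ − e₁ = 1`).  The quartic kernel (`p = 2`) is NOT included: its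
all-fixed size is the split's (H_j) / `IsoTupleL1AtS` (BGM 2006, Lemma 2.5 (2.98)). -/
def KernelNormsLevels (P : SplitConsts) (Q : EngConsts) (β U μ : ℝ) (K : TrigPolyC4v) (n : ℕ) : Prop :=
  ∀ p : ℕ, 3 ≤ p → ∀ Ωe : Fin (2 * p) → Option (SectorLeg (sectorCount n)),
    klAnisoLegKernelNormAt L M β U μ K klE0 n (2 * p) Ωe ≤
      Q.CE ^ p * (epsCoupling P U n) ^ (p - 1) * (2 : ℝ) ^ ((3 * (p : ℤ) - 5) * n) * (((2 : ℝ) ^ n)⁻¹) ^ levelGainExp (levelCount Ωe)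

/-- **`KernelNormsLevelsW`** — the Wick twin of `KernelNormsLevels` on `klWickAction` (for an engine proof run on the Wick carriers)
(BGM 2006, Lemma 2.5 (2.98)). -/
def KernelNormsLevelsW (P : SplitConsts) (Q : EngConsts) (β U μ : ℝ) (K : TrigPolyC4v) (n : ℕ) : Prop :=
  ∀ p : ℕ, 3 ≤ p → ∀ Ωe : Fin (2 * p) → Option (SectorLeg (sectorCount n)),
    klWickAnisoLegKernelNormAt L M β U μ K n (2 * p) Ωe ≤
      Q.CE ^ p * (epsCoupling P U n) ^ (p - 1) * (2 : ℝ) ^ ((3 * (p : ℤ) - 5) * n) * (((2 : ℝ) ^ n)⁻¹) ^ levelGainExp (levelCount Ωe)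

variable {L M}

/-- With nothing prescribed the levelled norm is the slot's `klAnisoLegKernelNorm`. [folklore] -/
theorem klAnisoLegKernelNormAt_none (β U μ : ℝ) (K : TrigPolyC4v) (e₀ : ℝ) (n m : ℕ) :
    klAnisoLegKernelNormAt L M β U μ K e₀ n m (fun _ => none) = klAnisoLegKernelNorm L M β U μ K e₀ n m := by
  rw [klAnisoLegKernelNormAt, prescribedTuples_none]
  rfl

/-- With nothing prescribed the levelled Wick norm is `klWickAnisoLegKernelNorm`. [folklore] -/
theorem klWickAnisoLegKernelNormAt_none (β U μ : ℝ) (K : TrigPolyC4v) (n m : ℕ) :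
    klWickAnisoLegKernelNormAt L M β U μ K n m (fun _ => none) = klWickAnisoLegKernelNorm L M β U μ K n m := by
  rw [klWickAnisoLegKernelNormAt, prescribedTuples_none]
  rfl

/-- **A prescription only drops tuples**: the levelled norm is at most the unrestricted one (`β ≥ 0`). [folklore] -/
theorem klAnisoLegKernelNormAt_le {β : ℝ} (hβ : 0 ≤ β) (U μ : ℝ) (K : TrigPolyC4v) (e₀ : ℝ) (n m : ℕ)
    (Ωe : Fin m → Option (SectorLeg (sectorCount n))) :
    klAnisoLegKernelNormAt L M β U μ K e₀ n m Ωe ≤ klAnisoLegKernelNorm L M β U μ K e₀ n m := by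
  rw [klAnisoLegKernelNormAt, klAnisoLegKernelNorm, hubbardSectorKernelNorm_def, hubbardSectorKernelNorm_def]
  exact sectorisedKernelNorm_mono_set (imagTimeWeight_nonneg hβ M) (prescribedTuples_subset _ _) _

/-- Refining a prescription can only lower the levelled norm (`β ≥ 0`). [folklore] -/
theorem klAnisoLegKernelNormAt_mono {β : ℝ} (hβ : 0 ≤ β) (U μ : ℝ) (K : TrigPolyC4v) (e₀ : ℝ) (n m : ℕ)
    {Ωe Ωe' : Fin m → Option (SectorLeg (sectorCount n))} (h : ∀ i, ∀ s ∈ Ωe i, Ωe' i = some s) :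
    klAnisoLegKernelNormAt L M β U μ K e₀ n m Ωe' ≤ klAnisoLegKernelNormAt L M β U μ K e₀ n m Ωe := by
  rw [klAnisoLegKernelNormAt, klAnisoLegKernelNormAt, hubbardSectorKernelNorm_def, hubbardSectorKernelNorm_def]
  exact sectorisedKernelNorm_mono_set (imagTimeWeight_nonneg hβ M) (prescribedTuples_mono _ h) _

/-- The Wick twin of `klAnisoLegKernelNormAt_le`. [folklore] -/
theorem klWickAnisoLegKernelNormAt_le {β : ℝ} (hβ : 0 ≤ β) (U μ : ℝ) (K : TrigPolyC4v) (n m : ℕ)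
    (Ωe : Fin m → Option (SectorLeg (sectorCount n))) :
    klWickAnisoLegKernelNormAt L M β U μ K n m Ωe ≤ klWickAnisoLegKernelNorm L M β U μ K n m := by
  rw [klWickAnisoLegKernelNormAt, klWickAnisoLegKernelNorm, hubbardSectorKernelNorm_def, hubbardSectorKernelNorm_def]
  exact sectorisedKernelNorm_mono_set (imagTimeWeight_nonneg hβ M) (prescribedTuples_subset _ _) _

/-- **The invariant adds content only from level three on**: every clause of `KernelNormsLevels` whose prescription fixes at most two legs
already follows from the public slot `KernelNormsV4` (same law, gain exponent `0`). [folklore] -/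
theorem kernelNormsLevels_clause_of_kernelNormsV4 {P : SplitConsts} {Q : EngConsts} {β U μ : ℝ} (hβ : 0 ≤ β) {K : TrigPolyC4v}
    {n : ℕ} (hE1 : KernelNormsV4 L M P Q β U μ K n) {p : ℕ} (hp : 3 ≤ p) (Ωe : Fin (2 * p) → Option (SectorLeg (sectorCount n)))
    (hF : levelCount Ωe ≤ 2) :
    klAnisoLegKernelNormAt L M β U μ K klE0 n (2 * p) Ωe ≤
      Q.CE ^ p * (epsCoupling P U n) ^ (p - 1) * (2 : ℝ) ^ ((3 * (p : ℤ) - 5) * n) * (((2 : ℝ) ^ n)⁻¹) ^ levelGainExp (levelCount Ωe) := by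
  rw [levelGainExp_eq_zero_of_le_two hF, pow_zero, mul_one]
  exact (klAnisoLegKernelNormAt_le hβ U μ K klE0 n (2 * p) Ωe).trans (hE1 p (by omega))

/-- The Wick twin of `kernelNormsLevels_clause_of_kernelNormsV4` (from `KernelNormsW`). [folklore] -/
theorem kernelNormsLevelsW_clause_of_kernelNormsW {P : SplitConsts} {Q : EngConsts} {β U μ : ℝ} (hβ : 0 ≤ β) {K : TrigPolyC4v}
    {n : ℕ} (hE1 : KernelNormsW L M P Q β U μ K n) {p : ℕ} (hp : 3 ≤ p) (Ωe : Fin (2 * p) → Option (SectorLeg (sectorCount n)))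
    (hF : levelCount Ωe ≤ 2) :
    klWickAnisoLegKernelNormAt L M β U μ K n (2 * p) Ωe ≤
      Q.CE ^ p * (epsCoupling P U n) ^ (p - 1) * (2 : ℝ) ^ ((3 * (p : ℤ) - 5) * n) * (((2 : ℝ) ^ n)⁻¹) ^ levelGainExp (levelCount Ωe) := by
  rw [levelGainExp_eq_zero_of_le_two hF, pow_zero, mul_one]
  exact (klWickAnisoLegKernelNormAt_le hβ U μ K n (2 * p) Ωe).trans (hE1 p (by omega))

/-- **The levelled bound is monotone in the gain exponent**: a clause proved with a LARGER exponent implies the clause as stated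
(`(2^n)⁻¹ ≤ 1`), so a supplier may prove the `F ≥ 5` law with exponent `2` and the `F ∈ {3,4}` law with exponent `1` uniformly.
[folklore] -/
theorem levels_rhs_mono {C : ℝ} (hC : 0 ≤ C) (n : ℕ) {g g' : ℕ} (hg : g ≤ g') :
    C * (((2 : ℝ) ^ n)⁻¹) ^ g' ≤ C * (((2 : ℝ) ^ n)⁻¹) ^ g := by
  refine mul_le_mul_of_nonneg_left (pow_le_pow_of_le_one (by positivity) ?_ hg) hC
  exact inv_le_one_of_one_le₀ (one_le_pow₀ (by norm_num))

end Model

end Summit.HubbardSuperconductivity.HubbardSuperconductivity.Theorems.KLRegimeSplit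

end
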